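import Mathlib
import Summits.NavierStokesRegularity.NavierStokesRegularity.Theorems.SymmetryModuliCountLinearLiouvilleSevenCaloricSliceLipschitz
import Summits.NavierStokesRegularity.NavierStokesRegularity.Theorems.SymmetryModuliCountLinearLiouvilleSevenAnchorGradientCaloric
import Literature.Analysis.FluidPDE.SpaceTimeCalculus
import Literature.Analysis.FluidPDE.HarmonicMeanValue
import HarnessLib

/-!
# Anchor of crux `LinearLiouvilleSeven` (route `SymmetryModuliCount`): bounded gradient increments

Helper file for item stmt-NavierStokesRegularity-4054 (`LinearLiouvilleSeven`, route
`SymmetryModuliCount`), line `galilean-collapse`, registered stub A3 `stub_anchorAssembly` (the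
`u = 0` ANCHOR: tempered classical ancient Stokes solutions on `(−∞, 0) × ℝ³` are slice-wise
constant). This file carries step (S1) of the anchor assembly and the elementary lemmas it needs;
the assembly itself is `Theorems/SymmetryModuliCountLinearLiouvilleSevenAnchorAssembly.lean`.

* `anchorAsm_increment_caloric`: increments `W(t, h + x) − W(t, x)` of a jointly smooth field with
  `∂ₜW = ΔW + γ(t)` (caloric up to a slice constant) are jointly smooth ancient caloric functions;
* `anchorAsm_const_of_increments`: a function on `ℝ³` with constant, bounded increments is
  constant (additive bounded maps vanish);
* `anchorAsm_abs_apply_le_of_lip`: converse mean value inequality, applied form;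
* `anchorAsm_increment_bound` **(S1)**: for a tempered ancient Stokes pair `(v, q)` with
  slice-constant `∇q`, `|⟪Dv(t, h + x) a − Dv(t, x) a, e⟫| ≤ 44K‖e‖‖a‖/(−t)` uniformly in `x, h`
  — the translation difference `⟪v(·, h + ·) − v, e⟫` is an ancient caloric function of linear
  growth, so the tree's slice-Lipschitz estimate `stub_caloricSliceLipschitz` (A2, Ishii–Lions)
  bounds its spatial derivative.

## References

* G. M. Lieberman, *Second order parabolic differential equations*, World Scientific 1996,
  Ch. II (interior estimates for caloric functions) [Lieberman1996].
* G. Koch, N. Nadirashvili, G. Seregin, V. Šverák, Acta Math. 203 (2009), §1, Prop. 4.1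
  (the tempered growth rates) [KNSS2009].
-/

noncomputable section

set_option linter.dupNamespace false -- tree namespace `Summit.<S>.<S>.Theorems` (summit = sub-problem) trips the core linter under standalone elaboration; the lakefile sets it weakly

open Set Function Filter InnerProductSpace
open scoped Laplacian ContDiff Topology RealInnerProductSpace

namespace Summit.NavierStokesRegularity.NavierStokesRegularity.Theorems

open Literature.Analysis.FluidPDE
/-! ### Translates and increments of jointly smooth fields -/

/-- Spatial translates of a jointly smooth field are jointly smooth. -/
theorem anchorAsm_isSmoothSpaceTimeOn_translate {F : Type*} [NormedAddCommGroup F]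
    [NormedSpace ℝ F] {S : Set ℝ} {W : ℝ → EuclideanSpace ℝ (Fin 3) → F}
    (hW : IsSmoothSpaceTimeOn S W) (h : EuclideanSpace ℝ (Fin 3)) :
    IsSmoothSpaceTimeOn S fun t x => W t (h + x) := by
  have hφ : ContDiff ℝ ∞ (fun z : ℝ × EuclideanSpace ℝ (Fin 3) => (z.1, h + z.2)) :=
    contDiff_fst.prodMk (contDiff_const.add contDiff_snd)
  have hmaps : MapsTo (fun z : ℝ × EuclideanSpace ℝ (Fin 3) => (z.1, h + z.2)) (S ×ˢ univ)
      (S ×ˢ univ) := fun z hz => ⟨hz.1, mem_univ _⟩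
  change ContDiffOn ℝ ∞ (uncurry W ∘ fun z : ℝ × EuclideanSpace ℝ (Fin 3) => (z.1, h + z.2))
    (S ×ˢ univ)
  exact hW.comp hφ.contDiffOn hmaps

/-- **Increments of "caloric up to a slice constant" fields are caloric.** If `W` is jointly
smooth on `(−∞, 0) × ℝ³` with `∂ₜW(t, x) = ΔW(t, ·)(x) + γ(t)`, then for every `h` the increment
field `D(t, x) = W(t, h + x) − W(t, x)` is jointly smooth and solves the heat equation. -/
theorem anchorAsm_increment_caloric {W : ℝ → EuclideanSpace ℝ (Fin 3) → ℝ} {γ : ℝ → ℝ}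
    (hW : IsSmoothSpaceTimeOn (Iio 0) W)
    (heq : ∀ t < 0, ∀ x, timeDeriv W t x = (Δ (W t)) x + γ t) (h : EuclideanSpace ℝ (Fin 3)) :
    IsSmoothSpaceTimeOn (Iio 0) (fun t x => W t (h + x) - W t x) ∧
      ∀ t < 0, ∀ x, timeDeriv (fun t x => W t (h + x) - W t x) t x =
        (Δ ((fun t x => W t (h + x) - W t x) t)) x := by
  have hWh : IsSmoothSpaceTimeOn (Iio 0) fun t x => W t (h + x) :=
    anchorAsm_isSmoothSpaceTimeOn_translate hW h
  refine ⟨hWh.sub hW, fun t ht x => ?_⟩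
  -- time derivative of the increment
  have h1 : HasDerivAt (fun s => W s (h + x)) (deriv (fun s => W s (h + x)) t) t :=
    hW.hasDerivAt_timeLine isOpen_Iio ht (h + x)
  have h2 : HasDerivAt (fun s => W s x) (deriv (fun s => W s x) t) t :=
    hW.hasDerivAt_timeLine isOpen_Iio ht x
  have hsub := h1.fun_sub h2
  rw [timeDeriv_apply, hsub.deriv, ← timeDeriv_apply W t (h + x), ← timeDeriv_apply W t x,
    heq t ht (h + x), heq t ht x]
  -- Laplacian of the increment
  have hWt : ContDiff ℝ ∞ (W t) := hW.contDiff_slice ht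
  have hWt2 : ContDiff ℝ 2 (W t) := hWt.of_le (by norm_cast)
  have hWht2 : ContDiff ℝ 2 (fun y => W t (h + y)) := hWt2.comp (contDiff_const.add contDiff_id)
  have e1 : (fun y => W t (h + y) - W t y) = (fun y => W t (h + y)) - W t := rfl
  show _ = (Δ (fun y => W t (h + y) - W t y)) x
  rw [e1, hWht2.contDiffAt.laplacian_sub hWt2.contDiffAt, laplacian_comp_const_add]
  ring

/-! ### Two elementary lemmas -/

/-- **A function with constant, bounded increments is constant.** If the increments
`g(h + x) − g(x)` of `g : ℝ³ → ℝ` do not depend on `x` and are bounded uniformly in `h`, then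
`g` is constant: `c(h) = g(h) − g(0)` is additive and bounded, `n·c(h) = c(n h)` is bounded in
`n`, so `c = 0`. -/
theorem anchorAsm_const_of_increments {g : EuclideanSpace ℝ (Fin 3) → ℝ} {L : ℝ}
    (hinc : ∀ x h, g (h + x) - g x = g h - g 0) (hbd : ∀ h, |g h - g 0| ≤ L)
    (x : EuclideanSpace ℝ (Fin 3)) : g x = g 0 := by
  -- `c h := g h - g 0` is additive
  have hadd : ∀ h₁ h₂, g (h₁ + h₂) - g 0 = (g h₁ - g 0) + (g h₂ - g 0) := by
    intro h₁ h₂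
    have := hinc h₂ h₁
    linarith
  have hnat : ∀ n : ℕ, ∀ h, g ((n : ℝ) • h) - g 0 = n * (g h - g 0) := by
    intro n h
    induction n with
    | zero => simp
    | succ n ih =>
      rw [Nat.cast_succ, add_smul, one_smul, add_comm ((n : ℝ) • h), hadd, ih]
      ring
  -- bounded + additive ⇒ zero
  have hzero : g x - g 0 = 0 := by
    by_contra hne
    have hpos : 0 < |g x - g 0| := abs_pos.2 hne
    obtain ⟨n, hn⟩ := exists_nat_gt (L / |g x - g 0|)
    have h1 := hbd ((n : ℝ) • x)
    rw [hnat n x, abs_mul, Nat.abs_cast] at h1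
    have h2 : L < n * |g x - g 0| := by rwa [div_lt_iff₀ hpos] at hn
    linarith
  linarith

/-- Converse of the mean value inequality, applied form: if `f` has derivative `f'` at `x` and
`|f y − f x| ≤ C‖y − x‖` for all `y`, then `|f' a| ≤ C‖a‖`. -/
theorem anchorAsm_abs_apply_le_of_lip {f : EuclideanSpace ℝ (Fin 3) → ℝ}
    {f' : EuclideanSpace ℝ (Fin 3) →L[ℝ] ℝ} {x : EuclideanSpace ℝ (Fin 3)} {C : ℝ} (hC : 0 ≤ C)
    (hf : HasFDerivAt f f' x) (hlip : ∀ y, |f y - f x| ≤ C * ‖y - x‖)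
    (a : EuclideanSpace ℝ (Fin 3)) : |f' a| ≤ C * ‖a‖ := by
  have h1 : ‖f'‖ ≤ C :=
    hf.le_of_lip' hC (Filter.Eventually.of_forall fun y => by
      rw [Real.norm_eq_abs]; exact hlip y)
  rw [← Real.norm_eq_abs]
  exact (f'.le_opNorm a).trans (mul_le_mul_of_nonneg_right h1 (norm_nonneg _))

/-! ### The growth constant is nonnegative; monotonicity of the envelope in time -/

/-- Any tempered velocity growth constant is nonnegative (evaluate at `t = -1`, `x = 0`). -/
theorem anchorAsm_K_nonneg {v : ℝ → EuclideanSpace ℝ (Fin 3) → EuclideanSpace ℝ (Fin 3)} {K : ℝ}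
    (hK : ∀ t < 0, ∀ x, ‖v t x‖ ≤ K / Real.sqrt (-t) + K * (1 + ‖x‖) / (-t)) : 0 ≤ K := by
  have h1 := hK (-1) (by norm_num) 0
  have h0 : (0 : ℝ) ≤ ‖v (-1) 0‖ := norm_nonneg _
  simp only [neg_neg, Real.sqrt_one, div_one, norm_zero, add_zero, mul_one] at h1
  linarith

/-- The tempered velocity envelope is monotone in time on `s ≤ t < 0`:
`K/√(−s) + K(1+‖x‖)/(−s) ≤ K/√(−t) + K(1+‖x‖)/(−t)`. -/
theorem anchorAsm_envelope_mono {K s t : ℝ} (hK : 0 ≤ K) (hst : s ≤ t) (ht : t < 0)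
    (x : EuclideanSpace ℝ (Fin 3)) :
    K / Real.sqrt (-s) + K * (1 + ‖x‖) / (-s) ≤ K / Real.sqrt (-t) + K * (1 + ‖x‖) / (-t) := by
  have hnt : 0 < -t := by linarith
  have hns : -t ≤ -s := by linarith
  have hsqt : 0 < Real.sqrt (-t) := Real.sqrt_pos.2 hnt
  have hsq : Real.sqrt (-t) ≤ Real.sqrt (-s) := Real.sqrt_le_sqrt hns
  have h1 : K / Real.sqrt (-s) ≤ K / Real.sqrt (-t) := div_le_div_of_nonneg_left hK hsqt hsq
  have h2 : K * (1 + ‖x‖) / (-s) ≤ K * (1 + ‖x‖) / (-t) :=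
    div_le_div_of_nonneg_left (by positivity) hnt hns
  linarith

/-! ### Step (S1): bounded increments of the velocity gradient -/

/-- **(S1)** For a tempered ancient Stokes pair with slice-constant pressure gradient, the
increments of the velocity-gradient entries are bounded at the scale-natural rate:
`|⟪Dv(t, h + x) a − Dv(t, x) a, e⟫| ≤ 44 K/(−t) · ‖e‖ ‖a‖`, uniformly in `x` and `h`. Proof:
`W_h = ⟪v(·, h + ·) − v, e⟫` is an ancient caloric function (the slice-constant `∇q` cancels) of
linear growth with slope `2K‖e‖/(−t)` on `s ≤ t`, so by the slice-Lipschitz estimate A2 the slice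
`W_h(t, ·)` is `44K‖e‖/(−t)`-Lipschitz; its derivative in the direction `a` is the increment. -/
theorem anchorAsm_increment_bound
    {v : ℝ → EuclideanSpace ℝ (Fin 3) → EuclideanSpace ℝ (Fin 3)}
    {q : ℝ → EuclideanSpace ℝ (Fin 3) → ℝ} {K : ℝ}
    (hv : IsSmoothSpaceTimeOn (Iio 0) v)
    (hK : ∀ t < 0, ∀ x, ‖v t x‖ ≤ K / Real.sqrt (-t) + K * (1 + ‖x‖) / (-t))
    (heq : ∀ t < 0, ∀ x, timeDeriv v t x = (Δ (v t)) x - gradient (q t) x)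
    (hP : ∀ t < 0, ∀ x, gradient (q t) x = gradient (q t) 0)
    {t : ℝ} (ht : t < 0) (x h a e : EuclideanSpace ℝ (Fin 3)) :
    |⟪fderiv ℝ (v t) (h + x) a - fderiv ℝ (v t) x a, e⟫| ≤ 44 * K / (-t) * ‖e‖ * ‖a‖ := by
  have hK0 : 0 ≤ K := anchorAsm_K_nonneg hK
  have hnt : 0 < -t := by linarith
  -- the scalar field `W = ⟪v, e⟫` is caloric up to the slice constant `-⟪∇q(·, 0), e⟫`
  set W : ℝ → EuclideanSpace ℝ (Fin 3) → ℝ := fun s y => ⟪v s y, e⟫ with hWdef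
  have hW : IsSmoothSpaceTimeOn (Iio 0) W := hv.inner (v' := fun _ _ => e) contDiffOn_const
  have heqW : ∀ s < 0, ∀ y, timeDeriv W s y = (Δ (W s)) y + (-⟪gradient (q s) 0, e⟫) := by
    intro s hs y
    have hd : HasDerivAt (fun r => v r y) (deriv (fun r => v r y) s) s :=
      hv.hasDerivAt_timeLine isOpen_Iio hs y
    have hdi := hd.inner ℝ (hasDerivAt_const s e)
    simp only [inner_zero_right, zero_add] at hdi
    have hv2 : ContDiff ℝ 2 (v s) := (hv.contDiff_slice hs).of_le (by norm_cast)
    rw [timeDeriv_apply, hdi.deriv, ← timeDeriv_apply v s y, heq s hs y, hP s hs y,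
      show W s = fun z => ⟪v s z, e⟫ from rfl, anchorGradCaloric_laplacian_inner_const hv2 e y,
      inner_sub_left]
    ring
  -- its increments `D` are caloric
  obtain ⟨hD, hDcal⟩ := anchorAsm_increment_caloric hW heqW h
  set D : ℝ → EuclideanSpace ℝ (Fin 3) → ℝ := fun s y => W s (h + y) - W s y with hDdef
  -- linear growth of `D` on `s ≤ t`
  set A : ℝ := ‖e‖ * (2 * K / Real.sqrt (-t) + K * (2 + ‖h‖) / (-t)) with hAdef
  set B : ℝ := ‖e‖ * (2 * K / (-t)) with hBdef
  have hA : 0 ≤ A := by positivity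
  have hB : 0 ≤ B := by positivity
  have hgrowth : ∀ s ≤ t, ∀ y, |D s y| ≤ A + B * ‖y‖ := by
    intro s hs y
    have hs0 : s < 0 := lt_of_le_of_lt hs ht
    have e1 : D s y = ⟪v s (h + y) - v s y, e⟫ := by
      simp only [hDdef, hWdef, inner_sub_left]
    have hb1 : ‖v s (h + y)‖ ≤ K / Real.sqrt (-t) + K * (1 + (‖h‖ + ‖y‖)) / (-t) := by
      calc ‖v s (h + y)‖ ≤ K / Real.sqrt (-s) + K * (1 + ‖h + y‖) / (-s) := hK s hs0 (h + y)
        _ ≤ K / Real.sqrt (-t) + K * (1 + ‖h + y‖) / (-t) := anchorAsm_envelope_mono hK0 hs ht _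
        _ ≤ K / Real.sqrt (-t) + K * (1 + (‖h‖ + ‖y‖)) / (-t) := by
          gcongr
          exact norm_add_le h y
    have hb2 : ‖v s y‖ ≤ K / Real.sqrt (-t) + K * (1 + ‖y‖) / (-t) :=
      (hK s hs0 y).trans (anchorAsm_envelope_mono hK0 hs ht y)
    calc |D s y| = |⟪v s (h + y) - v s y, e⟫| := by rw [e1]
      _ ≤ ‖v s (h + y) - v s y‖ * ‖e‖ := abs_real_inner_le_norm _ _
      _ ≤ (‖v s (h + y)‖ + ‖v s y‖) * ‖e‖ :=
          mul_le_mul_of_nonneg_right (norm_sub_le _ _) (norm_nonneg _)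
      _ ≤ ((K / Real.sqrt (-t) + K * (1 + (‖h‖ + ‖y‖)) / (-t)) +
            (K / Real.sqrt (-t) + K * (1 + ‖y‖) / (-t))) * ‖e‖ := by gcongr
      _ = A + B * ‖y‖ := by
          simp only [hAdef, hBdef]
          field_simp
          ring
  -- A2: the slice `D t` is `22 B`-Lipschitz
  have hlip : ∀ y₁ y₂, |D t y₂ - D t y₁| ≤ 22 * B * ‖y₂ - y₁‖ :=
    stub_caloricSliceLipschitz D t A B ht hD hDcal hA hB hgrowth
  -- the derivative of `D t` at `x` in the direction `a` is the increment
  have hvt : Differentiable ℝ (v t) := (hv.contDiff_slice ht).differentiable (by simp)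
  have hG : HasFDerivAt (fun y => v t (h + y) - v t y)
      (fderiv ℝ (v t) (h + x) - fderiv ℝ (v t) x) x := by
    have h1 : HasFDerivAt (fun y => v t (h + y)) (fderiv ℝ (v t) (h + x)) x :=
      (hasFDerivAt_comp_add_left h).2 (hvt (h + x)).hasFDerivAt
    exact h1.sub (hvt x).hasFDerivAt
  have hDt : HasFDerivAt (D t) ((innerSL ℝ e).comp (fderiv ℝ (v t) (h + x) - fderiv ℝ (v t) x))
      x := by
    have e2 : D t = fun y => (innerSL ℝ e) (v t (h + y) - v t y) := by
      funext y
      simp only [hDdef, hWdef, innerSL_apply_apply, inner_sub_right, real_inner_comm e]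
    rw [e2]
    exact (innerSL ℝ e).hasFDerivAt.comp x hG
  have key := anchorAsm_abs_apply_le_of_lip (by positivity) hDt (fun y => hlip x y) a
  rw [ContinuousLinearMap.comp_apply, innerSL_apply_apply, sub_apply] at key
  calc |⟪fderiv ℝ (v t) (h + x) a - fderiv ℝ (v t) x a, e⟫|
      = |⟪e, fderiv ℝ (v t) (h + x) a - fderiv ℝ (v t) x a⟫| := by rw [real_inner_comm]
    _ ≤ 22 * B * ‖a‖ := key
    _ = 44 * K / (-t) * ‖e‖ * ‖a‖ := by
        simp only [hBdef]
        ring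

/-! ### The registered form -/

/-- **Registered stub `stub_anchorIncrementBound` of item stmt-NavierStokesRegularity-4054 (step
(S1) of the anchor assembly A3, line `galilean-collapse`)**, in its registered `∀`-form:
`anchorAsm_increment_bound`. -/
theorem stub_anchorIncrementBound :
    ∀ (v : ℝ → EuclideanSpace ℝ (Fin 3) → EuclideanSpace ℝ (Fin 3))
      (q : ℝ → EuclideanSpace ℝ (Fin 3) → ℝ) (K : ℝ),
      ContDiffOn ℝ (⊤ : ℕ∞) (Function.uncurry v) (Set.Iio 0 ×ˢ Set.univ) →
      (∀ t < 0, ∀ x, ‖v t x‖ ≤ K / Real.sqrt (-t) + K * (1 + ‖x‖) / (-t)) →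
      (∀ t < 0, ∀ x, Literature.Analysis.FluidPDE.timeDeriv v t x =
        Laplacian.laplacian (v t) x - gradient (q t) x) →
      (∀ t < 0, ∀ x, gradient (q t) x = gradient (q t) 0) →
      ∀ t < 0, ∀ x h a e : EuclideanSpace ℝ (Fin 3),
        |inner ℝ (fderiv ℝ (v t) (h + x) a - fderiv ℝ (v t) x a) e| ≤
          44 * K / (-t) * ‖e‖ * ‖a‖ :=
  fun _ q _ hv hK heq hP _ ht x h a e => anchorAsm_increment_bound (q := q) hv hK heq hP ht x h a e

end Summit.NavierStokesRegularity.NavierStokesRegularity.Theorems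

end
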